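import Summits.AtomisticToContinuum.Crystallization.Theses.PhononSlackCertificates
import Summits.AtomisticToContinuum.Crystallization.Theorems.ReggeStarCoercivityDefectFreeCrystallizesSqueezeToLayeredA
import Summits.AtomisticToContinuum.Crystallization.Theorems.ReggeStarCoercivityStarCoercivityTwoShellGoodStarGood
import Summits.AtomisticToContinuum.Crystallization.Theorems.PhononSlackCertificatesHullBridgeWindows

/-!
# Clean centres for `HullBridge` (line `Sketch`, stub S3 `stub_cleanCentres`;
# crux stmt-AtomisticToContinuum-15147, `PhononSlackCertificates.HullBridge`)

Packing step of the line: along a Lennard-Jones ground-state sequence `x N`, if the fraction of sites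
that are not two-shell good (`IsTwoShellGood (1/20) (47/50) 1`) and, for a fixed `η > 0`, the fraction of
sites that are not `η`-layered (`PrestressSplitKorn.LayeredNear η`) both tend to `0`, then for every
radius `R'`, for all large `N`, some particle `i` has EVERY particle within `R'` of it both `Good` (the
sibling-crux goodness `DefectFreeCrystallizes.Negative.PredicateAPI.Good`, obtained from two-shell
goodness by `SeparationPaddingTransfer.stub_twoShellGoodStarGood`) and `η`-layered.

Proof: the exceptional set `Bad := {j : ¬ (two-shell good ∧ η-layered)}` has
`#Bad ≤ #{¬ two-shell good} + #{¬ η-layered} = o(N)`; ground states are `δ`-separated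
(`LennardJonesMinimalDistance_holds`), so the particles within `max R' 0` of `Bad` number at most
`#Bad · (2 max R' 0 / δ + 1)³ < N` eventually, and a particle outside this blocked set is a clean centre
(`hb_exists_far_from`).
-/

noncomputable section

open scoped BigOperators Classical
open Filter Topology

namespace Summit.AtomisticToContinuum.Crystallization.Theorems.HullBridgeExact

open Summit.AtomisticToContinuum.Crystallization.Theses.PhononSlackCertificates
open Summit.AtomisticToContinuum.Crystallization.Theorems.PrestressSplitKorn
open Summit.AtomisticToContinuum.Crystallization.Theorems.DefectFreeCrystallizes.Negative.PredicateAPI (Good)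
open Literature.MathematicalPhysics.StatisticalMechanics Literature.Geometry.DiscreteGeometry

local notation "E3" => EuclideanSpace ℝ (Fin 3)

/-- Two-shell goodness of a site of an injective configuration implies the sibling-crux goodness `Good`
(this is `SeparationPaddingTransfer.stub_twoShellGoodStarGood`, whose conclusion is `Good` unfolded). -/
theorem cc_good_of_isTwoShellGood {N : ℕ} {x : Fin N → E3} (hx : Function.Injective x) {i : Fin N}
    (h : IsTwoShellGood (1 / 20) (47 / 50) 1 x i) : Good x i :=
  SeparationPaddingTransfer.stub_twoShellGoodStarGood N x i hx h

/-- The exceptional sites (not two-shell good or not `η`-layered) number at most the non-two-shell-good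
sites plus the non-`η`-layered sites. -/
theorem cc_card_bad_le {N : ℕ} (x : Fin N → E3) (η : ℝ) :
    ((Finset.univ.filter fun j : Fin N =>
        ¬ (IsTwoShellGood (1 / 20) (47 / 50) 1 x j ∧ LayeredNear η x j)).card : ℝ) ≤
      (Nat.card {i : Fin N // ¬ IsTwoShellGood (1 / 20) (47 / 50) 1 x i} : ℝ) +
        ((Finset.univ.filter fun i : Fin N => ¬ LayeredNear η x i).card : ℝ) := by
  rw [Nat.card_eq_fintype_card, Fintype.card_subtype]
  have hsub : (Finset.univ.filter fun j : Fin N =>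
        ¬ (IsTwoShellGood (1 / 20) (47 / 50) 1 x j ∧ LayeredNear η x j)) ⊆
      (Finset.univ.filter fun i : Fin N => ¬ IsTwoShellGood (1 / 20) (47 / 50) 1 x i) ∪
        (Finset.univ.filter fun i : Fin N => ¬ LayeredNear η x i) := by
    intro j hj
    have hj' := (Finset.mem_filter.1 hj).2
    rw [not_and_or] at hj'
    rcases hj' with h | h
    · exact Finset.mem_union_left _ (Finset.mem_filter.2 ⟨Finset.mem_univ _, h⟩)
    · exact Finset.mem_union_right _ (Finset.mem_filter.2 ⟨Finset.mem_univ _, h⟩)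
  calc ((Finset.univ.filter fun j : Fin N =>
          ¬ (IsTwoShellGood (1 / 20) (47 / 50) 1 x j ∧ LayeredNear η x j)).card : ℝ)
      ≤ (((Finset.univ.filter fun i : Fin N => ¬ IsTwoShellGood (1 / 20) (47 / 50) 1 x i) ∪
          (Finset.univ.filter fun i : Fin N => ¬ LayeredNear η x i)).card : ℝ) := by
        exact_mod_cast Finset.card_le_card hsub
    _ ≤ _ := by exact_mod_cast Finset.card_union_le _ _

/-- **Clean centres** (stub S3 of line `Sketch` for `PhononSlackCertificates.HullBridge`): if along a
Lennard-Jones ground-state sequence the fraction of non-two-shell-good sites and, for every `η > 0`, the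
fraction of non-`η`-layered sites vanish, then for every `η > 0` and every radius `R'`, for all large `N`
some particle has every particle within `R'` of it `Good` and `η`-layered. -/
theorem stub_cleanCentres (x : (N : ℕ) → (Fin N → E3)) (hx : ∀ N, IsGroundState lennardJones (x N))
    (hbad : Tendsto (fun N : ℕ =>
      (Nat.card {i : Fin N // ¬ IsTwoShellGood (1 / 20) (47 / 50) 1 (x N) i} : ℝ) / N) atTop (𝓝 0))
    (hnl : ∀ η : ℝ, 0 < η → Tendsto (fun N : ℕ =>
      ((Finset.univ.filter fun i : Fin N => ¬ LayeredNear η (x N) i).card : ℝ) / N) atTop (𝓝 0))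
    {η : ℝ} (hη : 0 < η) (R' : ℝ) :
    ∀ᶠ N : ℕ in atTop, ∃ i : Fin N, ∀ j : Fin N, dist (x N j) (x N i) ≤ R' →
      Good (x N) j ∧ LayeredNear η (x N) j := by
  obtain ⟨δ, hδ, hsepall⟩ := LennardJonesMinimalDistance_holds
  -- the packing constant `M` and the clean-ball lemma, abstracted
  obtain ⟨M, hM0, hfar⟩ : ∃ M : ℝ, 0 < M ∧ ∀ (N : ℕ) (D : Finset (Fin N)), (D.card : ℝ) * M < N →
      ∃ i : Fin N, ∀ j : Fin N, dist (x N j) (x N i) ≤ R' → j ∉ D :=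
    ⟨(2 * max R' 0 / δ + 1) ^ 3, by positivity, fun N D hD =>
      let ⟨i, hi⟩ := hb_exists_far_from (x N) hδ (le_max_right R' 0) (hsepall N (x N) (hx N)) D hD
      ⟨i, fun j hj => hi j (hj.trans (le_max_left _ _))⟩⟩
  have hsumt := (hbad.add (hnl η hη)).const_mul M
  rw [add_zero, mul_zero] at hsumt
  filter_upwards [hsumt.eventually_lt_const zero_lt_one, eventually_gt_atTop 0] with N hN1 hN0
  have hNpos : (0 : ℝ) < N := by exact_mod_cast hN0
  rw [← add_div, ← mul_div_assoc, div_lt_iff₀ hNpos, one_mul] at hN1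
  obtain ⟨i, hi⟩ := hfar N (Finset.univ.filter fun j : Fin N =>
      ¬ (IsTwoShellGood (1 / 20) (47 / 50) 1 (x N) j ∧ LayeredNear η (x N) j))
    (by nlinarith [mul_le_mul_of_nonneg_left (cc_card_bad_le (x N) η) hM0.le])
  refine ⟨i, fun j hj => ?_⟩
  have hgood : IsTwoShellGood (1 / 20) (47 / 50) 1 (x N) j ∧ LayeredNear η (x N) j := by
    by_contra h
    exact hi j hj (Finset.mem_filter.2 ⟨Finset.mem_univ _, h⟩)
  exact ⟨cc_good_of_isTwoShellGood (hx N).1 hgood.1, hgood.2⟩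

end Summit.AtomisticToContinuum.Crystallization.Theorems.HullBridgeExact

end
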